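import Literature.MathematicalPhysics.QuantumFieldTheory.Balaban1983to89.B15SU2ChartHolomorphic
import Literature.MathematicalPhysics.QuantumFieldTheory.Balaban1983to89.T4CubeChartExp
import Literature.MathematicalPhysics.QuantumFieldTheory.Balaban1983to89.UnitaryModel

/-!
# (GR-b′) ORGAN LEMMA (i⁺) + CONCLUSION: the flat-anchored one-bond excitation of a GAUGE-INVARIANT function is EVEN, hence has ZERO GRADIENT at the anchor

`CURRENCY-MEMO-g26.md` §10.5–§10.7; critic #576 (hole (i)–(v)); LEAD №15∕№18.
* `gaugeAct_const_update_one` — a CONSTANT gauge transformation `u ≡ h` maps the flat configuration with bond `b` excited to `g` to the flat configuration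
  with `b` excited to `h * g * h⁻¹` (elsewhere `h·1·h⁻¹ = 1`).
* ★ `flat_excitation_even` — for `GaugeField.GaugeInvariant R`: `R (update 1 b (expPt (−v))) = R (update 1 b (expPt v))`
  (by `ChartOdd.exists_conj_expPt_eq_expPt_neg`: the excitation by `−v` is a global gauge conjugate of the excitation by `v`).
* `ConstConjInvariantAtFlat R` — the MINIMAL invariance used: `R (update 1 b (h g h⁻¹)) = R (update 1 b g)` (global rotations at flat one-bond
  excitations; implied by Setup's `GaugeInvariant`, `constConjInvariantAtFlat_of_gaugeInvariant`); `…_of_constConj` entry points (critic #578).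
* ★★ `flatGradient_zero` — if moreover `v ↦ R (update 1 b (expPt v))` is differentiable at `0`, its Fréchet derivative there is `0`:
  the anchored gradient letter `g⁰_b` of TN-GR VANISHES (abstract step = `GREven.fderiv_zero_of_even`, restated here by text).
WHAT THIS DOES NOT DO: (i) gauge invariance of the organ's `log ρ_j`, `log ρ′_j` on the window is a HYPOTHESIS here (`GaugeInvariant R`), to be
supplied from `descend`'s gauge-covariance (LEAD); (iv) differentiability is a HYPOTHESIS, to be supplied from (β); (v) row∕column symmetrisation is
the telescope's business.  HONEST: symmetry bookkeeping, kernel-checked; nothing about the runs; nothing of O1∕O1ᵘ-H∕S3∕20520∕`YM3TorusSU2` proved;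
registry №36 intact; R3 = SU(2) YM₃ on T³ — NOT d = 4, NOT infinite volume, NOT a mass gap, NOT Clay.
-/

/-! ### Local copy of `SU2ConjInv` (HOME file `SU2ConjInv.lean`, restated BY TEXT so this file is self-contained) -/

namespace Summit.QuantumFields.YangMills.Cruxes.FluctuationComparisonRegPrIntL.GRFlatEven.ChartOdd.SU2ConjInvLocal

open Matrix ComplexConjugate

/-- Entry relations of a special unitary 2×2 matrix: `M 1 1 = conj (M 0 0)` and `M 1 0 = - conj (M 0 1)`. -/
theorem su2_entries (M : Matrix (Fin 2) (Fin 2) ℂ) (hU : M * star M = 1) (hdet : M.det = 1) :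
    M 1 1 = conj (M 0 0) ∧ M 1 0 = -conj (M 0 1) := by
  have hinv : M⁻¹ = star M := Matrix.inv_eq_right_inv hU
  have hadj : M⁻¹ = M.adjugate := by
    rw [Matrix.inv_def, hdet]; simp
  have hstar : star M = M.adjugate := by rw [← hinv, hadj]
  have h11 : (star M) 0 0 = M.adjugate 0 0 := by rw [hstar]
  have h10 : (star M) 1 0 = M.adjugate 1 0 := by rw [hstar]
  rw [Matrix.adjugate_fin_two] at h11 h10
  simp [Matrix.star_apply] at h11 h10
  constructor
  · rw [← h11]
  · rw [h10]; ring

/-- The witness computation, abstracted: `H = !![0, c; -conj c, 0]` with `c·conj c = 1`, `c²·conj b = −b` conjugates `M = !![a, b; -conj b, conj a]` to `star M`. -/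
theorem conj_witness (M : Matrix (Fin 2) (Fin 2) ℂ) (h11 : M 1 1 = conj (M 0 0)) (h10 : M 1 0 = -conj (M 0 1)) (c : ℂ)
    (hc : c * conj c = 1) (hc2 : c * c * conj (M 0 1) = -M 0 1) (hc3 : conj c * conj c * M 0 1 = -conj (M 0 1)) :
    (!![0, c; -conj c, 0] : Matrix (Fin 2) (Fin 2) ℂ) * star (!![0, c; -conj c, 0] : Matrix (Fin 2) (Fin 2) ℂ) = 1 ∧
    Matrix.det (!![0, c; -conj c, 0] : Matrix (Fin 2) (Fin 2) ℂ) = 1 ∧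
    (!![0, c; -conj c, 0] : Matrix (Fin 2) (Fin 2) ℂ) * M * star (!![0, c; -conj c, 0] : Matrix (Fin 2) (Fin 2) ℂ) = star M := by
  refine ⟨?_, ?_, ?_⟩
  · ext i j
    simp only [Matrix.mul_apply, Fin.sum_univ_two, Matrix.star_eq_conjTranspose, Matrix.conjTranspose_apply]
    fin_cases i <;> fin_cases j <;> simp <;> linear_combination hc
  · simp [Matrix.det_fin_two]; linear_combination hc
  · ext i j
    simp only [Matrix.mul_apply, Fin.sum_univ_two, Matrix.star_eq_conjTranspose, Matrix.conjTranspose_apply]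
    fin_cases i <;> fin_cases j <;> simp [h11, h10]
    · linear_combination (conj (M 0 0)) * hc
    · linear_combination hc2
    · linear_combination (-1 : ℂ) * hc3
    · linear_combination (M 0 0) * hc

/-- ★ Every special unitary 2×2 matrix is conjugate, by a special unitary matrix, to its adjoint (= inverse). -/
theorem su2_conj_to_star (M : Matrix (Fin 2) (Fin 2) ℂ) (hU : M * star M = 1) (hdet : M.det = 1) :
    ∃ H : Matrix (Fin 2) (Fin 2) ℂ, H * star H = 1 ∧ H.det = 1 ∧ H * M * star H = star M := by
  obtain ⟨h11, h10⟩ := su2_entries M hU hdet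
  by_cases hb : M 0 1 = 0
  · -- diagonal case: c = 1
    refine ⟨!![0, 1; -conj 1, 0], conj_witness M h11 h10 1 (by simp) (by simp [hb]) (by simp [hb])⟩
  · set b : ℂ := M 0 1 with hbdef
    set n : ℝ := ‖b‖ with hndef
    have hn : n ≠ 0 := by rw [hndef]; exact norm_ne_zero_iff.mpr hb
    have hnC : (n : ℂ) ≠ 0 := by exact_mod_cast hn
    have hbb : b * conj b = ((n : ℂ)) ^ 2 := by
      rw [Complex.mul_conj, hndef, Complex.normSq_eq_norm_sq]; push_cast; ring
    set c : ℂ := Complex.I * b / n with hcdef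
    have hconjc : conj c = -(Complex.I * conj b / n) := by
      rw [hcdef]; simp [map_div₀, map_mul, Complex.conj_I, Complex.conj_ofReal]; ring
    have hc : c * conj c = 1 := by
      rw [hconjc, hcdef]
      have : Complex.I * b / ↑n * -(Complex.I * conj b / ↑n) = -(Complex.I * Complex.I) * (b * conj b) / (n : ℂ) ^ 2 := by ring
      rw [this, Complex.I_mul_I, hbb]; field_simp
    have hc2 : c * c * conj b = -b := by
      rw [hcdef]
      have : Complex.I * b / ↑n * (Complex.I * b / ↑n) * conj b = (Complex.I * Complex.I) * b * (b * conj b) / (n : ℂ) ^ 2 := by ring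
      rw [this, Complex.I_mul_I, hbb]; field_simp
    have hc3 : conj c * conj c * b = -conj b := by
      have := congrArg conj hc2
      simpa [map_mul, map_neg] using this
    exact ⟨!![0, c; -conj c, 0], conj_witness M h11 h10 c hc hc2 hc3⟩

/-- ★★ GROUP-LEVEL FORM, as the organ needs it (`SU2 := ↥(Matrix.specialUnitaryGroup (Fin 2) ℂ)`): every element of SU(2) is conjugate IN SU(2) to its inverse —
so the one-bond excitation by `−v` (= the inverse of `expPt v`, lemma (ii′)) is a GLOBAL GAUGE CONJUGATE of the excitation by `v`. -/
theorem su2_exists_conj_eq_inv (g : Matrix.specialUnitaryGroup (Fin 2) ℂ) :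
    ∃ h : Matrix.specialUnitaryGroup (Fin 2) ℂ, h * g * h⁻¹ = g⁻¹ := by
  have hg := Matrix.mem_specialUnitaryGroup_iff.1 g.2
  have hU : (g : Matrix (Fin 2) (Fin 2) ℂ) * star (g : Matrix (Fin 2) (Fin 2) ℂ) = 1 := Matrix.mem_unitaryGroup_iff.1 hg.1
  obtain ⟨H, hH1, hH2, hH3⟩ := su2_conj_to_star (g : Matrix (Fin 2) (Fin 2) ℂ) hU hg.2
  have hHmem : H ∈ Matrix.specialUnitaryGroup (Fin 2) ℂ :=
    Matrix.mem_specialUnitaryGroup_iff.2 ⟨Matrix.mem_unitaryGroup_iff.2 hH1, hH2⟩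
  refine ⟨⟨H, hHmem⟩, ?_⟩
  apply Subtype.ext
  exact hH3

end Summit.QuantumFields.YangMills.Cruxes.FluctuationComparisonRegPrIntL.GRFlatEven.ChartOdd.SU2ConjInvLocal

namespace Summit.QuantumFields.YangMills.Cruxes.FluctuationComparisonRegPrIntL.GRFlatEven.ChartOdd

open Literature.MathematicalPhysics.QuantumFieldTheory.Balaban1983to89
open B15SU2ChartHolomorphic (expPointC coe_expPoint_eq_expPointC genE)
open T4HaarSU2ExpChart (expPoint)
open T4CubeChartExp (expPt toE)
open NormedSpace (exp)

/-- `expPointC (−z) = (expPointC z)⁻¹` (`e^{−M} = (e^{M})⁻¹`). -/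
theorem expPointC_neg (z : EuclideanSpace ℂ (Fin 3)) : expPointC (-z) = (expPointC z)⁻¹ := by
  rw [expPointC, expPointC, ← Matrix.exp_neg]
  congr 1
  rw [← Finset.sum_neg_distrib]
  refine Finset.sum_congr rfl fun a _ => ?_
  simp [neg_smul]

/-- In `SU(2)` the inverse, read in matrices, is the matrix inverse. -/
theorem coe_inv_eq_matrix_inv (g : Matrix.specialUnitaryGroup (Fin 2) ℂ) :
    ((g⁻¹ : Matrix.specialUnitaryGroup (Fin 2) ℂ) : Matrix (Fin 2) (Fin 2) ℂ) = (g : Matrix (Fin 2) (Fin 2) ℂ)⁻¹ := by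
  have hU : (g : Matrix (Fin 2) (Fin 2) ℂ) * star (g : Matrix (Fin 2) (Fin 2) ℂ) = 1 :=
    Matrix.mem_unitaryGroup_iff.1 (Matrix.mem_specialUnitaryGroup_iff.1 g.2).1
  rw [Matrix.inv_eq_right_inv hU]
  rfl

/-- ★ (ii′) `expPoint (−x) = (expPoint x)⁻¹` in `SU(2)`. -/
theorem expPoint_neg (x : EuclideanSpace ℝ (Fin 3)) : expPoint (-x) = (expPoint x)⁻¹ := by
  apply Subtype.ext
  rw [coe_inv_eq_matrix_inv, coe_expPoint_eq_expPointC, coe_expPoint_eq_expPointC, ← expPointC_neg]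
  congr 1
  ext a
  simp

/-- ★ (ii′) for coordinate vectors: `expPt (−v) = (expPt v)⁻¹`. -/
theorem expPt_neg (v : Fin 3 → ℝ) : expPt (-v) = (expPt v)⁻¹ := by
  rw [expPt, expPt, ← expPoint_neg]
  rfl

/-- ★★ THE EXCITATION BY `−v` IS A GLOBAL GAUGE CONJUGATE OF THE EXCITATION BY `v`: `∃ h : SU2, h * expPt v * h⁻¹ = expPt (−v)`
(with `h * 1 * h⁻¹ = 1` on every other bond, a constant gauge transformation maps the one-bond excitation `W(v)` to `W(−v)`). -/
theorem exists_conj_expPt_eq_expPt_neg (v : Fin 3 → ℝ) :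
    ∃ h : Matrix.specialUnitaryGroup (Fin 2) ℂ, h * expPt v * h⁻¹ = expPt (-v) := by
  obtain ⟨h, hh⟩ := SU2ConjInvLocal.su2_exists_conj_eq_inv (expPt v)
  exact ⟨h, by rw [hh, expPt_neg]⟩

end Summit.QuantumFields.YangMills.Cruxes.FluctuationComparisonRegPrIntL.GRFlatEven.ChartOdd

namespace Summit.QuantumFields.YangMills.Cruxes.FluctuationComparisonRegPrIntL.GRFlatEven

open Literature.MathematicalPhysics.QuantumFieldTheory.Balaban1983to89
open T4CubeChartExp (expPt)
open T4CubeChartGnomonic (SU2)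
open Function (update)

variable {P : Params} {j : ℕ}

/-- A CONSTANT gauge transformation conjugates a one-bond excitation of the flat configuration. -/
theorem gaugeAct_const_update_one (h g : SU2) (b : PBond P j) :
    GaugeField.gaugeAct (fun _ => h) (update (1 : GaugeField P j SU2) b g) = update (1 : GaugeField P j SU2) b (h * g * h⁻¹) := by
  funext e
  rw [GaugeField.gaugeAct]
  by_cases he : e = b
  · subst he
    simp
  · rw [Function.update_of_ne he, Function.update_of_ne he]
    show h * 1 * h⁻¹ = 1
    rw [mul_one, mul_inv_cancel]

/-- THE MINIMAL INVARIANCE actually used (critic #578 sharpening): `R` is invariant under GLOBAL rotations at one-bond excitations of the flat field. -/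
def ConstConjInvariantAtFlat (R : GaugeField P j SU2 → ℝ) : Prop :=
  ∀ (h : SU2) (b : PBond P j) (g : SU2), R (update (1 : GaugeField P j SU2) b (h * g * h⁻¹)) = R (update (1 : GaugeField P j SU2) b g)

/-- Setup's GLOBAL gauge invariance implies the minimal one (constant transformations `fun _ => h`). -/
theorem constConjInvariantAtFlat_of_gaugeInvariant (R : GaugeField P j SU2 → ℝ) (hR : GaugeField.GaugeInvariant R) :
    ConstConjInvariantAtFlat R := by
  intro h b g
  rw [← gaugeAct_const_update_one h g b]
  exact hR (fun _ => h) _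

/-- ★ (i⁺, minimal form) the flat-anchored one-bond excitation is EVEN in the chart coordinate. -/
theorem flat_excitation_even_of_constConj (R : GaugeField P j SU2 → ℝ) (hR₀ : ConstConjInvariantAtFlat R) (b : PBond P j) (v : Fin 3 → ℝ) :
    R (update (1 : GaugeField P j SU2) b (expPt (-v))) = R (update (1 : GaugeField P j SU2) b (expPt v)) := by
  obtain ⟨h, hh⟩ := ChartOdd.exists_conj_expPt_eq_expPt_neg v
  rw [← hh]
  exact hR₀ h b (expPt v)

/-- ★ (i⁺) For a gauge-invariant function, the flat-anchored one-bond excitation is EVEN in the chart coordinate. -/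
theorem flat_excitation_even (R : GaugeField P j SU2 → ℝ) (hR : GaugeField.GaugeInvariant R) (b : PBond P j) (v : Fin 3 → ℝ) :
    R (update (1 : GaugeField P j SU2) b (expPt (-v))) = R (update (1 : GaugeField P j SU2) b (expPt v)) :=
  flat_excitation_even_of_constConj R (constConjInvariantAtFlat_of_gaugeInvariant R hR) b v

/-- An even function differentiable at `0` has zero Fréchet derivative at `0` (= `GREven.fderiv_zero_of_even`, restated by text). -/
theorem fderiv_zero_of_even {E : Type*} [NormedAddCommGroup E] [NormedSpace ℝ E] (f : E → ℝ) (heven : ∀ v : E, f (-v) = f v)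
    (hd : DifferentiableAt ℝ f 0) : fderiv ℝ f 0 = 0 := by
  set L : E →L[ℝ] ℝ := fderiv ℝ f 0 with hL
  have h : HasFDerivAt f L 0 := hd.hasFDerivAt
  have hneg : HasFDerivAt (fun v : E => -v) (-(ContinuousLinearMap.id ℝ E)) (0 : E) := (hasFDerivAt_id (0 : E)).neg
  have h0 : HasFDerivAt f L ((fun v : E => -v) 0) := by simpa using h
  have hcomp : HasFDerivAt (f ∘ fun v : E => -v) (L.comp (-(ContinuousLinearMap.id ℝ E))) 0 := h0.comp 0 hneg
  have hfe : (f ∘ fun v : E => -v) = f := funext fun v => heven v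
  rw [hfe] at hcomp
  have huniq : L = L.comp (-(ContinuousLinearMap.id ℝ E)) := h.unique hcomp
  ext v
  have hv : L v = L (-v) := by
    have := congrArg (fun T : E →L[ℝ] ℝ => T v) huniq
    simpa using this
  rw [map_neg] at hv
  have hz : L v = 0 := by linarith
  simpa using hz

/-- ★★ (minimal form) THE ANCHORED GRADIENT LETTER VANISHES under global-rotation invariance at flat one-bond excitations + differentiability at the anchor. -/
theorem flatGradient_zero_of_constConj (R : GaugeField P j SU2 → ℝ) (hR₀ : ConstConjInvariantAtFlat R) (b : PBond P j)
    (hd : DifferentiableAt ℝ (fun v : Fin 3 → ℝ => R (update (1 : GaugeField P j SU2) b (expPt v))) 0) :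
    fderiv ℝ (fun v : Fin 3 → ℝ => R (update (1 : GaugeField P j SU2) b (expPt v))) 0 = 0 :=
  fderiv_zero_of_even _ (fun v => by simpa using flat_excitation_even_of_constConj R hR₀ b v) hd

/-- ★★ THE ANCHORED GRADIENT LETTER VANISHES: for gauge-invariant `R` differentiable at the flat anchor along the one-bond chart at `b`,
`fderiv ℝ (fun v => R (update 1 b (expPt v))) 0 = 0`. -/
theorem flatGradient_zero (R : GaugeField P j SU2 → ℝ) (hR : GaugeField.GaugeInvariant R) (b : PBond P j)
    (hd : DifferentiableAt ℝ (fun v : Fin 3 → ℝ => R (update (1 : GaugeField P j SU2) b (expPt v))) 0) :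
    fderiv ℝ (fun v : Fin 3 → ℝ => R (update (1 : GaugeField P j SU2) b (expPt v))) 0 = 0 :=
  fderiv_zero_of_even _ (fun v => by simpa using flat_excitation_even R hR b v) hd

/-- Directional form: every directional derivative of the anchored excitation vanishes — `g⁰_b = 0` in TN-GR's (GR-a) letters. -/
theorem flatGradient_apply_zero (R : GaugeField P j SU2 → ℝ) (hR : GaugeField.GaugeInvariant R) (b : PBond P j)
    (hd : DifferentiableAt ℝ (fun v : Fin 3 → ℝ => R (update (1 : GaugeField P j SU2) b (expPt v))) 0) (w : Fin 3 → ℝ) :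
    fderiv ℝ (fun v : Fin 3 → ℝ => R (update (1 : GaugeField P j SU2) b (expPt v))) 0 w = 0 := by
  simp [flatGradient_zero R hR b hd]

end Summit.QuantumFields.YangMills.Cruxes.FluctuationComparisonRegPrIntL.GRFlatEven
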